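import Summits.Ventures.CertifiedQuantumChemistry.Rows.V2RDMDualKernelTerms
import HarnessLib

/-!
# Ventures/CertifiedQuantumChemistry — Rows/V2RDMDualKernelResidual.lean: drop-zeros / keyed merge sort / grouping / ℓ¹ bound, the a-priori |moment| ≤ 1 bounds, the objective and the equality rows as linear forms

HONEST FRAMING (verbatim): certified bounds for a stated model Hamiltonian in a stated basis; not a
claim about the real molecule beyond that model.

PART OF `Rows/V2RDMDualKernel.lean` (rdm-A g61, KERNEL-SDP): the kernel-replayed v2RDM dual SDP certificate ⇒ `LowerRow`.
The development is split into `Rows/V2RDMDualKernelTerms.lean` → `…Residual.lean` → `…Blocks.lean`, `…Pack.lean` → `Rows/V2RDMDualKernel.lean`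
(the entry points `lowerRow_of_check` / `lowerRow_of_staged` and the full account live in the last file); one namespace
`Summit.Ventures.CertifiedQuantumChemistry.V2RDMDual` throughout, so declaration names do not depend on the file split.
-/

namespace Summit.Ventures.CertifiedQuantumChemistry

open Matrix Finset
open scoped ComplexOrder
open Literature.MathematicalPhysics.QuantumLattice Literature.MathematicalPhysics.QuantumChemistry

namespace V2RDMDual

section Semantics

variable {k : ℕ} [NeZero k] {γ : M1 k} {Γ : M2 k}

/-! ## Dropping zeros, sorting (a permutation), grouping equal moments, the ℓ¹ bound -/

/-- Drop zero-coefficient terms. -/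
def dropZero (l : List Term) : List Term := l.filter fun t => t.1 ≠ 0

/-- Dropping zero-coefficient terms preserves the value. -/
theorem termsVal_dropZero (l : List Term) : termsVal k γ Γ (dropZero l) = termsVal k γ Γ l := by
  induction l with
  | nil => rfl
  | cons t l ih =>
    simp only [dropZero, List.filter_cons] at ih ⊢
    split_ifs with h
    · rw [termsVal_cons, termsVal_cons, ih]
    · have h0 : t.1 = 0 := by simpa using h
      rw [ih, termsVal_cons, h0]; simp

/-- A sort key (any key is sound; this one makes equal canonical descriptors adjacent). -/
def Desc.key (n : ℕ) : Desc → ℕ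
  | .one x y => x * n + y
  | .two x₁ x₂ y₁ y₂ => n * n + ((x₁ * n + x₂) * n + y₁) * n + y₂

/-- A term tagged with its precomputed sort key. -/
abbrev KTerm := ℕ × Term

/-- Fuelled merge of two key-tagged lists (keys compared as naturals; computed once per term). -/
def mergeF : ℕ → List KTerm → List KTerm → List KTerm
  | 0, xs, ys => xs ++ ys
  | _ + 1, [], ys => ys
  | _ + 1, xs, [] => xs
  | f + 1, x :: xs, y :: ys =>
    if x.1 ≤ y.1 then x :: mergeF f xs (y :: ys) else y :: mergeF f (x :: xs) ys

/-- The fuelled merge of two keyed lists is a permutation of their concatenation. -/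
theorem mergeF_perm : ∀ (f : ℕ) (xs ys : List KTerm), (mergeF f xs ys).Perm (xs ++ ys)
  | 0, xs, ys => by simp [mergeF]
  | _ + 1, [], ys => by simp [mergeF]
  | f + 1, x :: xs, [] => by simp [mergeF]
  | f + 1, x :: xs, y :: ys => by
    unfold mergeF
    split_ifs
    · exact (mergeF_perm f xs (y :: ys)).cons x
    · have h1 := (mergeF_perm f (x :: xs) ys).cons y
      exact h1.trans (List.perm_middle.symm)

/-- One pass: merge adjacent pairs of runs. -/
def mergePairs : List (List KTerm) → List (List KTerm)
  | a :: b :: rest => mergeF (a.length + b.length) a b :: mergePairs rest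
  | l => l

/-- One round of pairwise merging permutes the flattened input. -/
theorem flatten_mergePairs_perm : ∀ (ls : List (List KTerm)), (mergePairs ls).flatten.Perm ls.flatten
  | [] => by simp [mergePairs]
  | [a] => by simp [mergePairs]
  | a :: b :: rest => by
    simp only [mergePairs, List.flatten_cons]
    have h1 := mergeF_perm (a.length + b.length) a b
    have h2 := flatten_mergePairs_perm rest
    simpa [List.append_assoc] using h1.append h2

/-- Fuelled bottom-up merge sort of runs. -/
def mergeAll : ℕ → List (List KTerm) → List KTerm
  | 0, ls => ls.flatten
  | _ + 1, [] => []
  | _ + 1, [l] => l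
  | f + 1, a :: b :: rest => mergeAll f (mergePairs (a :: b :: rest))

/-- The fuelled merge of a list of keyed lists permutes the flattened input. -/
theorem mergeAll_perm : ∀ (f : ℕ) (ls : List (List KTerm)), (mergeAll f ls).Perm ls.flatten
  | 0, ls => by simp [mergeAll]
  | _ + 1, [] => by simp [mergeAll]
  | _ + 1, [l] => by simp [mergeAll]
  | f + 1, a :: b :: rest => by
    rw [mergeAll]
    exact (mergeAll_perm f _).trans (flatten_mergePairs_perm _)

/-- Sort terms by key (keys computed once; only its being a permutation is used). -/
def sortTerms (n : ℕ) (l : List Term) : List Term :=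
  (mergeAll l.length (l.map fun t => [(t.2.key n, t)])).map Prod.snd

/-- Un-keying the singleton keyed lists returns the original terms. -/
theorem flatten_map_singleton (n : ℕ) (l : List Term) :
    ((l.map fun t => [(t.2.key n, t)]).flatten).map Prod.snd = l := by
  induction l with
  | nil => rfl
  | cons t l ih => simpa using ih

/-- The keyed merge sort permutes its input. -/
theorem sortTerms_perm (n : ℕ) (l : List Term) : (sortTerms n l).Perm l := by
  have h := (mergeAll_perm l.length (l.map fun t => [(t.2.key n, t)])).map Prod.snd
  rw [flatten_map_singleton] at h
  exact h

/-- Boolean structural equality of descriptors, field-wise by `Nat.beq`. The kernel evaluates it by arithmetic on the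
(evaluated) indices alone — unlike the derived `DecidableEq`, whose `subst` steps make the kernel run a definitional-equality
check between the two index EXPRESSIONS (catastrophically slow when they are digits decoded from different packed literals). -/
def Desc.beq : Desc → Desc → Bool
  | .one a b, .one a' b' => Nat.beq a a' && Nat.beq b b'
  | .two a b c d, .two a' b' c' d' => Nat.beq a a' && Nat.beq b b' && Nat.beq c c' && Nat.beq d d'
  | _, _ => false

/-- `Desc.beq` is sound: structurally equal descriptors are equal. -/
theorem Desc.eq_of_beq {x y : Desc} (h : Desc.beq x y = true) : x = y := by
  cases x <;> cases y <;> simp_all [Desc.beq]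

/-- Group ADJACENT terms with equal descriptors, adding coefficients (equality tested by `Desc.beq`). -/
def group : List Term → List Term
  | [] => []
  | t :: rest =>
    match group rest with
    | [] => [t]
    | g :: gs => bif Desc.beq t.2 g.2 then (t.1 + g.1, g.2) :: gs else t :: g :: gs

/-- Grouping adjacent equal moments preserves the value of a form. -/
theorem termsVal_group : ∀ (l : List Term), termsVal k γ Γ (group l) = termsVal k γ Γ l
  | [] => by simp [group]
  | t :: rest => by
    have ih := termsVal_group rest
    rw [group]
    cases hg : group rest with
    | nil => rw [hg] at ih; simp [← ih]
    | cons g gs =>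
      rw [hg] at ih
      simp only
      cases he : Desc.beq t.2 g.2
      · simp only [cond_false]; rw [termsVal_cons, ih, termsVal_cons]
      · simp only [cond_true]
        rw [termsVal_cons, termsVal_cons, ← ih, termsVal_cons, Desc.eq_of_beq he]; push_cast; ring

/-- The ℓ¹ norm of the coefficients. -/
def l1 (l : List Term) : ℚ := (l.map fun t => |t.1|).sum

/-- If every moment is bounded by `1` in absolute value, a form is bounded below by minus its ℓ¹ norm. -/
theorem neg_l1_le (hb : ∀ d, |Desc.val k γ Γ d| ≤ 1) : ∀ (l : List Term), -(l1 l : ℝ) ≤ termsVal k γ Γ l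
  | [] => by simp [l1]
  | t :: l => by
    have ih := neg_l1_le hb l
    have e : l1 (t :: l) = |t.1| + l1 l := rfl
    rw [e, termsVal_cons]
    push_cast
    have h1 : |(t.1 : ℝ) * Desc.val k γ Γ t.2| ≤ |(t.1 : ℝ)| := by
      rw [abs_mul]; exact mul_le_of_le_one_right (abs_nonneg _) (hb _)
    have h2 := neg_abs_le ((t.1 : ℝ) * Desc.val k γ Γ t.2)
    linarith

/-! ## A-priori bounds `|Re γ_xy| ≤ 1`, `|Re Γ_PQ| ≤ 1` on the DQG-feasible set -/

section Bounds

open Literature.LinearAlgebra.Matrix in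
/-- A-priori bound: every raw moment of a DQG-feasible pair has real part in `[-1, 1]` (Pauli on `γ`, the `G`-diagonal on `Γ`). -/
theorem abs_val_le_one {N : ℕ} (h : IsDQGFeasible N γ Γ) (hr : N + 2 ≤ Fintype.card (Orb (Fin k))) (d : Desc) :
    |Desc.val k γ Γ d| ≤ 1 := by
  have hdiag : ∀ i, (γ i i).re ≤ 1 := fun i => h.diag_le_one hr i
  cases d with
  | one x y =>
    simp only [Desc.val]
    have h1 := norm_apply_le_of_posSemidef h.one_posSemidef (so k x) (so k y)
    simp only [RCLike.re_to_complex] at h1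
    have h2 := Complex.abs_re_le_norm (γ (so k x) (so k y))
    linarith [hdiag (so k x), hdiag (so k y)]
  | two x₁ x₂ y₁ y₂ =>
    simp only [Desc.val]
    have hG : ∀ P : Orb (Fin k) × Orb (Fin k), (Γ P P).re ≤ 1 := by
      intro P
      have h0 := (Complex.nonneg_iff.mp (h.g_psd.diag_nonneg (i := P))).1
      simp only [gMap, ↓reduceIte, Complex.sub_re, Prod.mk.eta] at h0
      linarith [hdiag P.1]
    have h1 := norm_apply_le_of_posSemidef h.d_psd (so k x₁, so k x₂) (so k y₁, so k y₂)
    simp only [RCLike.re_to_complex] at h1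
    have h2 := Complex.abs_re_le_norm (Γ (so k x₁, so k x₂) (so k y₁, so k y₂))
    linarith [hG (so k x₁, so k x₂), hG (so k y₁, so k y₂)]

end Bounds

/-! ## The objective: `Re E(γ, Γ)` as a linear form in raw moments -/

/-- The objective terms of `rdmEnergy` at the model's tables (constant `F.ecore` kept apart). -/
def objTerms (F : Model k) : List Term :=
  ((List.finRange k).flatMap fun p => (List.finRange k).flatMap fun q =>
      emit (F.h p q) [.one p q, .one (p + k) (q + k)]) ++
  ((List.finRange k).flatMap fun p => (List.finRange k).flatMap fun q =>
    (List.finRange k).flatMap fun r => (List.finRange k).flatMap fun s =>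
      emit (F.eri p q r s / 2)
        [.two p r q s, .two p (r + k) q (s + k), .two (p + k) r (q + k) s, .two (p + k) (r + k) (q + k) (s + k)])

/-- The real part of the 2-RDM energy functional is `ecore` plus the value of the objective form `objTerms`. -/
theorem re_rdmEnergy_eq (F : Model k) (γ : M1 k) (Γ : M2 k) :
    (rdmEnergy (fun p q => (F.h p q : ℂ)) (fun p q r s => (F.eri p q r s : ℂ)) (F.ecore : ℂ) γ Γ).re =
      (F.ecore : ℝ) + termsVal k γ Γ (objTerms F) := by
  have hh : (1 / 2 : ℂ) = ((1 / 2 : ℚ) : ℂ) := by push_cast; ring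
  have h1 : ∀ p q : Fin k, termsVal k γ Γ (emit (F.h p q) [.one p q, .one (p + k) (q + k)]) =
      (F.h p q : ℝ) * ((γ (orb p 0) (orb q 0)).re + (γ (orb p 1) (orb q 1)).re) := by
    intro p q; rw [termsVal_emit]; simp [Desc.val, so_fin0, so_fin1]
  have h2 : ∀ p q r s : Fin k, termsVal k γ Γ (emit (F.eri p q r s / 2)
        [.two p r q s, .two p (r + k) q (s + k), .two (p + k) r (q + k) s, .two (p + k) (r + k) (q + k) (s + k)]) =
      (F.eri p q r s / 2 : ℝ) * ((Γ (orb p 0, orb r 0) (orb q 0, orb s 0)).re + (Γ (orb p 0, orb r 1) (orb q 0, orb s 1)).re +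
        (Γ (orb p 1, orb r 0) (orb q 1, orb s 0)).re + (Γ (orb p 1, orb r 1) (orb q 1, orb s 1)).re) := by
    intro p q r s; rw [termsVal_emit]; push_cast; simp [Desc.val, so_fin0, so_fin1, add_assoc]
  rw [rdmEnergy, hh]
  simp only [Complex.add_re, Complex.re_sum, Complex.mul_re, Complex.ratCast_re, Complex.ratCast_im, zero_mul,
    sub_zero, Fin.sum_univ_two, objTerms, termsVal_append, termsVal_flatMap, list_sum_finRange, h1, h2,
    Finset.mul_sum]
  push_cast
  have e3 : ∀ p q r s : Fin k, (1 / 2 : ℝ) * ((F.eri p q r s : ℝ) *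
      ((Γ (orb p 0, orb r 0) (orb q 0, orb s 0)).re + (Γ (orb p 0, orb r 1) (orb q 0, orb s 1)).re +
        ((Γ (orb p 1, orb r 0) (orb q 1, orb s 0)).re + (Γ (orb p 1, orb r 1) (orb q 1, orb s 1)).re))) =
      (F.eri p q r s : ℝ) / 2 * ((Γ (orb p 0, orb r 0) (orb q 0, orb s 0)).re + (Γ (orb p 0, orb r 1) (orb q 0, orb s 1)).re +
        (Γ (orb p 1, orb r 0) (orb q 1, orb s 0)).re + (Γ (orb p 1, orb r 1) (orb q 1, orb s 1)).re) := by
    intros; ring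
  simp only [e3]
  ring

/-! ## The equality rows (spin traces E1, spin-resolved contraction rows E2) -/

/-- A row: constant and terms; on the sector-feasible set `const + Σ terms = 0`. -/
abbrev Row := ℚ × List Term

/-- E1: `Σ_p γ_{pσ,pσ} − N_σ = 0`. -/
def rowsE1 (k a b : ℕ) : List Row :=
  [(-(a : ℚ), (List.finRange k).map fun p : Fin k => ((1 : ℚ), Desc.one p p)),
   (-(b : ℚ), (List.finRange k).map fun p : Fin k => ((1 : ℚ), Desc.one (p + k) (p + k)))]

/-- E2 `(σ, τ, p, q)`: `Σ_y Γ_{(pσ,yτ),(qσ,yτ)} − (N_τ − [σ = τ]) γ_{pσ,qσ} = 0`. -/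
def rowE2 (k a b : ℕ) (σ τ : Fin 2) (p q : Fin k) : Row :=
  (0, ((List.finRange k).map fun y : Fin k => ((1 : ℚ), Desc.two (xo k σ p) (xo k τ y) (xo k σ q) (xo k τ y))) ++
    [(-((if τ = 0 then (a : ℚ) else b) - if σ = τ then 1 else 0), Desc.one (xo k σ p) (xo k σ q))])

/-- All E2 rows, `σ, τ ∈ {α, β}`, `p ≤ q`. -/
def rowsE2 (k a b : ℕ) : List Row :=
  [((0 : Fin 2), (0 : Fin 2)), (0, 1), (1, 0), (1, 1)].flatMap fun στ =>
    (List.finRange k).flatMap fun p => (List.finRange k).flatMap fun q =>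
      if p ≤ q then [rowE2 k a b στ.1 στ.2 p q] else []

/-- The row menu the certificate's multipliers refer to (in this order). -/
def rowList (k a b : ℕ) : List Row := rowsE1 k a b ++ rowsE2 k a b

/-- The value of a row. -/
def rowVal (r : Row) : ℝ := (r.1 : ℝ) + termsVal k γ Γ r.2

/-- Real part of a natural-number multiple. -/
theorem re_natCast_mul (n : ℕ) (z : ℂ) : ((n : ℂ) * z).re = n * z.re := by
  simp [Complex.mul_re]

/-- Each spin-resolved contraction row (E2) vanishes on the sector-feasible set. -/
theorem rowE2_val {a b : ℕ} (h : IsDQGFeasibleSector a b γ Γ) (hab : a + b ≠ 0) (σ τ : Fin 2) (p q : Fin k) :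
    rowVal (k := k) (γ := γ) (Γ := Γ) (rowE2 k a b σ τ p q) = 0 := by
  simp only [rowVal, rowE2, termsVal_append, termsVal_cons, termsVal_nil, Rat.cast_zero, zero_add, add_zero]
  have hs : termsVal k γ Γ ((List.finRange k).map fun y : Fin k =>
      ((1 : ℚ), Desc.two (xo k σ p) (xo k τ y) (xo k σ q) (xo k τ y))) =
      (∑ y : Fin k, Γ (orb p σ, orb y τ) (orb q σ, orb y τ)).re := by
    rw [termsVal, List.map_map, Complex.re_sum, list_sum_finRange]
    refine Finset.sum_congr rfl fun y _ => ?_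
    simp [Desc.val, so_xo]
  rw [hs]
  simp only [Desc.val, so_xo]
  fin_cases σ <;> fin_cases τ
  · have e := congrArg Complex.re (sum_two_upUp_of_isDQGFeasibleSector h hab (orb p 0) q)
    simp only [Complex.mul_re, Complex.sub_re, Complex.natCast_re, Complex.one_re, Complex.sub_im,
      Complex.natCast_im, Complex.one_im, sub_zero, zero_mul] at e
    simp [e]; ring
  · have e := congrArg Complex.re (sum_two_upDown_of_isDQGFeasibleSector h hab (orb p 0) q)
    simp only [Complex.mul_re, Complex.natCast_re, Complex.natCast_im, zero_mul, sub_zero] at e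
    simp [e]
  · have e := congrArg Complex.re (sum_two_downUp_of_isDQGFeasibleSector h hab (orb p 1) q)
    simp only [Complex.mul_re, Complex.natCast_re, Complex.natCast_im, zero_mul, sub_zero] at e
    simp [e]
  · have e := congrArg Complex.re (sum_two_downDown_of_isDQGFeasibleSector h hab (orb p 1) q)
    simp only [Complex.mul_re, Complex.sub_re, Complex.natCast_re, Complex.one_re, Complex.sub_im,
      Complex.natCast_im, Complex.one_im, sub_zero, zero_mul] at e
    simp [e]; ring

/-- The two spin-trace rows (E1) vanish on the sector-feasible set. -/
theorem rowsE1_val {a b : ℕ} (h : IsDQGFeasibleSector a b γ Γ) :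
    ∀ r ∈ rowsE1 k a b, rowVal (k := k) (γ := γ) (Γ := Γ) r = 0 := by
  intro r hr
  simp only [rowsE1, List.mem_cons, List.mem_nil_iff, or_false] at hr
  have eu := congrArg Complex.re h.trace_up
  have ed := congrArg Complex.re h.trace_down
  rw [Complex.re_sum, Complex.natCast_re] at eu ed
  rcases hr with rfl | rfl
  · simp only [rowVal, termsVal, List.map_map, list_sum_finRange]
    have : ∑ x : Fin k, ((fun t : Term => (t.1 : ℝ) * Desc.val k γ Γ t.2) ∘ fun p : Fin k => ((1 : ℚ), Desc.one p p)) x =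
        ∑ x : Fin k, (γ (orb x 0) (orb x 0)).re := Finset.sum_congr rfl fun x _ => by simp [Desc.val, so_fin0]
    rw [this, eu]; push_cast; ring
  · simp only [rowVal, termsVal, List.map_map, list_sum_finRange]
    have : ∑ x : Fin k, ((fun t : Term => (t.1 : ℝ) * Desc.val k γ Γ t.2) ∘ fun p : Fin k => ((1 : ℚ), Desc.one (p + k) (p + k))) x =
        ∑ x : Fin k, (γ (orb x 1) (orb x 1)).re := Finset.sum_congr rfl fun x _ => by simp [Desc.val, so_fin1]
    rw [this, ed]; push_cast; ring

/-- Every equality row of the programme vanishes on the sector-feasible set. -/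
theorem rowList_val {a b : ℕ} (h : IsDQGFeasibleSector a b γ Γ) (hab : a + b ≠ 0) :
    ∀ r ∈ rowList k a b, rowVal (k := k) (γ := γ) (Γ := Γ) r = 0 := by
  intro r hr
  rw [rowList, List.mem_append] at hr
  rcases hr with hr | hr
  · exact rowsE1_val h r hr
  · simp only [rowsE2, List.mem_flatMap, List.mem_cons, List.mem_nil_iff, or_false] at hr
    obtain ⟨στ, -, p, -, q, -, hr⟩ := hr
    split_ifs at hr with hpq
    · simp only [List.mem_singleton] at hr
      rw [hr]; exact rowE2_val h hab στ.1 στ.2 p q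
    · simp at hr

end Semantics

end V2RDMDual

end Summit.Ventures.CertifiedQuantumChemistry
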